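import Mathlib
import Summits.Ventures.HodgeRepro2.T5AdicCompletionIntegral
import Summits.Ventures.HodgeRepro2.T5ConductorFormulaDVR
import Summits.Ventures.HodgeRepro2.T5LocalFieldDictionary
import Summits.Ventures.HodgeRepro2.T5ValuedBallBasis
import Summits.Ventures.HodgeRepro2.T5RamificationIndexUniformizer

/-!
# T5AdicCompletionConductor — the conductor formula `n(ψ ∘ Tr_{Lw/Kv}) = e · n(ψ) + d` on
Mathlib's number-field completions

Blind cell pub-hodge-repro2, seat p4 (Tier-5 Lean support, annex growth only).
Declaration per README §8(d): uses an L-value-free non-vanishing device: NO.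

The (A6) kernel chain (rows 63 → 70 → 69 → 71) proves the conductor formula for an abstract DVR
pair `A ⊆ B` in the AKLB setting, with the uniformisers, the different `(π ^ d)`, the torsion-
freeness and the valuation-ring identifications as HYPOTHESES. On Mathlib's concrete local fields
`Kv := v.adicCompletion K`, `Lw := w.adicCompletion L` (number fields `K ⊆ L`, Mathlib's own
`[Algebra Kv Lw] [ContinuousSMul Kv Lw] [IsScalarTower K Kv Lw]`) every one of those hypotheses
is now supplied: the valuation rings are `adicCompletionIntegers` (Mathlib), the DVR pair is AKLB
with `B` the integral closure (p395773, p395866), irreducible elements are exactly the elements of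
valuation `exp (-1)` (Mathlib's `IsUniformizer` API — `irreducible_iff_val_eq_exp_neg_one`),
`O_Lw` is torsion-free and finite over `O_Kv` and the different is `(π ^ d)` (p394509), and a
continuous circle-valued additive character is trivial on a ball (p395675). Hence, for every
continuous non-trivial `ψ : AddChar Kv Circle`:

  `n(ψ ∘ Tr_{Lw/Kv}) = e · n(ψ) + d`, `e` = Mathlib's `ramificationIdx'`, `(π ^ d)` = the different,

and in the ramified quadratic case `n(ψ ∘ Tr) = 2 n(ψ) + d` (`conductorExp_comp_trace_eq_two_mul_add`).

§4 adds the (A13) PARITY statement on the same pair (row 68's `even_conductor_of_inertiaDeg'_eq_one`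
with its dictionary hypotheses discharged): at a ramified quadratic place (`[Lw : Kv] = 2`, `f = 1`),
for `√D = s ∈ O_Lw ∖ O_Kv` and `δ = c · s`, the conductor `n(ψ ∘ Tr ∘ (δ ·))` of the twisted
character is EVEN (`even_conductorExp_comp_trace_mulLeft`); the trace is continuous
(`LinearMap.continuous_of_finiteDimensional` over the complete field `Kv`), so `ψ ∘ Tr` is trivial
on a ball (p395675) and row 67's twist formula applies. Nothing here is asserted about the Tier-5
datum: `D`, `s`, `δ`, `c` are hypotheses.
-/

namespace Summit.Ventures.HodgeRepro2.T5AdicCompletionConductor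

open IsDedekindDomain HeightOneSpectrum NumberField WithZero Valuation
open scoped WithZero

/-! ## §1 Uniformisers of `adicCompletionIntegers` are the elements of valuation `exp (-1)` -/

section Uniformizer

variable {R : Type*} [CommRing R] [IsDedekindDomain R] {K : Type*} [Field K] [Algebra R K]
  [IsFractionRing R K] (v : HeightOneSpectrum R)

/-- In `O_Kv` the irreducible elements are exactly the elements of valuation `exp (-1)`
(Mathlib's `irreducible_iff_uniformizer`, `IsUniformizer.is_generator`,
`isUniformizer_of_maximalIdeal_eq_span`, and `generator_eq_exp_neg_one_of_surjective`). -/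
theorem irreducible_iff_val_eq_exp_neg_one (ϖ : v.adicCompletionIntegers K) :
    Irreducible ϖ ↔ Valued.v (ϖ : v.adicCompletion K) = exp (-1) := by
  have hgen : (inferInstance :
      (Valued.v : Valuation (v.adicCompletion K) ℤᵐ⁰).IsRankOneDiscrete).generator =
      Units.mk0 (exp (-1 : ℤ) : ℤᵐ⁰) (by simp) :=
    Valuation.IsRankOneDiscrete.generator_eq_exp_neg_one_of_surjective
      (valuedAdicCompletion_surjective K v)
  rw [IsDiscreteValuationRing.irreducible_iff_uniformizer]
  constructor
  · intro h
    have := Valuation.isUniformizer_of_maximalIdeal_eq_span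
      (v := (Valued.v : Valuation (v.adicCompletion K) ℤᵐ⁰)) (r := ϖ) h
    rw [Valuation.IsUniformizer.iff, hgen] at this
    exact this
  · intro h
    have hu : (Valued.v : Valuation (v.adicCompletion K) ℤᵐ⁰).IsUniformizer
        (ϖ : v.adicCompletion K) := by
      rw [Valuation.IsUniformizer.iff, hgen]; exact h
    exact Valuation.IsUniformizer.is_generator hu

/-- `O_Kv` has a uniformiser (Mathlib: a DVR has an irreducible element). -/
theorem exists_irreducible : ∃ ϖ : v.adicCompletionIntegers K, Irreducible ϖ :=
  IsDiscreteValuationRing.exists_irreducible _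

/-- A uniformiser of `Kv` lies in `O_Kv` and is irreducible there. -/
theorem exists_irreducible_val_eq_exp_neg_one :
    ∃ ϖ : v.adicCompletionIntegers K, Irreducible ϖ ∧
      Valued.v (ϖ : v.adicCompletion K) = exp (-1) :=
  let ⟨ϖ, hϖ⟩ := exists_irreducible v
  ⟨ϖ, hϖ, (irreducible_iff_val_eq_exp_neg_one v ϖ).mp hϖ⟩

end Uniformizer

/-! ## §2 The concrete DVR pair: torsion-free, finite, the different is `(π ^ d)` -/

section Pair

variable {K : Type*} [Field K] [NumberField K] (v : HeightOneSpectrum (𝓞 K))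
variable {L : Type*} [Field L] [NumberField L] [Algebra K L] (w : HeightOneSpectrum (𝓞 L))
variable [Algebra (v.adicCompletion K) (w.adicCompletion L)]
  [ContinuousSMul (v.adicCompletion K) (w.adicCompletion L)]
  [IsScalarTower K (v.adicCompletion K) (w.adicCompletion L)]

omit [Algebra K L] [IsScalarTower K (v.adicCompletion K) (w.adicCompletion L)] in
/-- `O_Lw` is torsion-free over `O_Kv` (p394509). -/
instance isTorsionFree_adicCompletionIntegers :
    Module.IsTorsionFree (v.adicCompletionIntegers K) (w.adicCompletionIntegers L) :=
  T5LocalFieldDictionary.isTorsionFree (v.adicCompletionIntegers K) (v.adicCompletion K)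
    (w.adicCompletion L) (w.adicCompletionIntegers L)

/-- `O_Lw` is a finite `O_Kv`-module (p394509 — Mathlib's `IsIntegralClosure.isNoetherian`
through the integral closure of p395866). -/
instance finite_adicCompletionIntegers :
    Module.Finite (v.adicCompletionIntegers K) (w.adicCompletionIntegers L) :=
  T5LocalFieldDictionary.finite (v.adicCompletionIntegers K) (v.adicCompletion K)
    (w.adicCompletion L) (w.adicCompletionIntegers L)

/-- The different of `O_Lw / O_Kv` is `(π ^ d)` for a uniformiser `π` of `O_Lw` (p394509). -/
theorem exists_differentIdeal_eq_span_pow (π : w.adicCompletionIntegers L) (hπ : Irreducible π) :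
    ∃ d : ℕ, differentIdeal (v.adicCompletionIntegers K) (w.adicCompletionIntegers L) =
      Ideal.span {π ^ d} :=
  T5LocalFieldDictionary.exists_differentIdeal_eq_span_pow (v.adicCompletionIntegers K)
    (v.adicCompletion K) (w.adicCompletion L) (w.adicCompletionIntegers L) π hπ

/-! ## §3 The conductor formula on the concrete pair -/

/-- THE CONDUCTOR FORMULA on Mathlib's number-field completions, with every hypothesis of the
abstract chain (row 71, p395296) supplied: for an additive character `ψ` of `Kv` trivial on some
ball and non-trivial, `n(ψ ∘ Tr_{Lw/Kv}) = e · n(ψ) + d` where `e = ramificationIdx'`,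
`(π ^ d)` = the different, for irreducible `ϖ ∈ O_Kv`, `π ∈ O_Lw`. -/
theorem conductorExp_comp_trace_eq {M : Type*} [Monoid M] (ψ : AddChar (v.adicCompletion K) M)
    (hψ₀ : ∃ k : ℤ, ∀ y : v.adicCompletion K, Valued.v y ≤ exp k → ψ y = 1)
    (hψ₁ : ∃ y, ψ y ≠ 1) (ϖ : v.adicCompletionIntegers K) (hϖ : Irreducible ϖ)
    (π : w.adicCompletionIntegers L) (hπ : Irreducible π) (d : ℕ)
    (hd : differentIdeal (v.adicCompletionIntegers K) (w.adicCompletionIntegers L) =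
      Ideal.span {π ^ d}) :
    T5AdditiveConductor.conductorExp
        (ψ.compAddMonoidHom (Algebra.trace (v.adicCompletion K) (w.adicCompletion L)).toAddMonoidHom)
        (Valued.v : Valuation (w.adicCompletion L) ℤᵐ⁰) =
      ((Ideal.span {ϖ}).ramificationIdx' (Ideal.span {π}) : ℤ) *
          T5AdditiveConductor.conductorExp ψ (Valued.v : Valuation (v.adicCompletion K) ℤᵐ⁰) + d :=
  T5ConductorFormulaDVR.conductorExp_comp_trace_eq_of_ramificationIdx'
    (v.adicCompletionIntegers K) (v.adicCompletion K) (w.adicCompletion L)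
    (w.adicCompletionIntegers L) Valued.v Valued.v ψ (adicCompletionIntegers.integers K v)
    (adicCompletionIntegers.integers L w) ϖ hϖ ((irreducible_iff_val_eq_exp_neg_one v ϖ).mp hϖ)
    π hπ ((irreducible_iff_val_eq_exp_neg_one w π).mp hπ) _ rfl d hd hψ₀ hψ₁

/-- The conductor formula for a CONTINUOUS non-trivial circle-valued additive character of `Kv`
(the «trivial on a ball» hypothesis discharged by p395675), packaged existentially: there are
`e ≥ 1` and `d` with `n(ψ ∘ Tr) = e · n(ψ) + d`, `e` the ramification index and `(π ^ d)` the
different. -/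
theorem exists_conductorExp_comp_trace_eq (ψ : AddChar (v.adicCompletion K) Circle)
    (hψ : Continuous ψ) (hψ₁ : ∃ y, ψ y ≠ 1) :
    ∃ (ϖ : v.adicCompletionIntegers K) (π : w.adicCompletionIntegers L) (d : ℕ),
      Irreducible ϖ ∧ Irreducible π ∧
      differentIdeal (v.adicCompletionIntegers K) (w.adicCompletionIntegers L) =
        Ideal.span {π ^ d} ∧
      T5AdditiveConductor.conductorExp
          (ψ.compAddMonoidHom
            (Algebra.trace (v.adicCompletion K) (w.adicCompletion L)).toAddMonoidHom)
          (Valued.v : Valuation (w.adicCompletion L) ℤᵐ⁰) =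
        ((Ideal.span {ϖ}).ramificationIdx' (Ideal.span {π}) : ℤ) *
            T5AdditiveConductor.conductorExp ψ (Valued.v : Valuation (v.adicCompletion K) ℤᵐ⁰) +
          d := by
  obtain ⟨ϖ, hϖ⟩ := exists_irreducible (K := K) v
  obtain ⟨π, hπ⟩ := exists_irreducible (K := L) w
  obtain ⟨d, hd⟩ := exists_differentIdeal_eq_span_pow v w π hπ
  exact ⟨ϖ, π, d, hϖ, hπ, hd, conductorExp_comp_trace_eq v w ψ
    (T5ValuedBallBasis.exists_forall_le_exp_eq_one_of_continuous ψ hψ) hψ₁ ϖ hϖ π hπ d hd⟩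

/-- The RAMIFIED QUADRATIC form: `[Lw : Kv] = 2` and `f = 1` give `n(ψ ∘ Tr) = 2 n(ψ) + d`
(row 71's `conductorExp_comp_trace_eq_two_mul_add` on the concrete pair). -/
theorem conductorExp_comp_trace_eq_two_mul_add
    (h2 : Module.finrank (v.adicCompletion K) (w.adicCompletion L) = 2) {M : Type*} [Monoid M]
    (ψ : AddChar (v.adicCompletion K) M)
    (hψ₀ : ∃ k : ℤ, ∀ y : v.adicCompletion K, Valued.v y ≤ exp k → ψ y = 1)
    (hψ₁ : ∃ y, ψ y ≠ 1) (ϖ : v.adicCompletionIntegers K) (hϖ : Irreducible ϖ)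
    (π : w.adicCompletionIntegers L) (hπ : Irreducible π)
    (hf : (Ideal.span {ϖ}).inertiaDeg' (Ideal.span {π}) = 1) (d : ℕ)
    (hd : differentIdeal (v.adicCompletionIntegers K) (w.adicCompletionIntegers L) =
      Ideal.span {π ^ d}) :
    T5AdditiveConductor.conductorExp
        (ψ.compAddMonoidHom (Algebra.trace (v.adicCompletion K) (w.adicCompletion L)).toAddMonoidHom)
        (Valued.v : Valuation (w.adicCompletion L) ℤᵐ⁰) =
      2 * T5AdditiveConductor.conductorExp ψ (Valued.v : Valuation (v.adicCompletion K) ℤᵐ⁰) + d :=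
  T5ConductorFormulaDVR.conductorExp_comp_trace_eq_two_mul_add
    (v.adicCompletionIntegers K) (v.adicCompletion K) (w.adicCompletion L)
    (w.adicCompletionIntegers L) Valued.v Valued.v h2 ψ (adicCompletionIntegers.integers K v)
    (adicCompletionIntegers.integers L w) ϖ hϖ ((irreducible_iff_val_eq_exp_neg_one v ϖ).mp hϖ)
    π hπ ((irreducible_iff_val_eq_exp_neg_one w π).mp hπ) hf d hd hψ₀ hψ₁

/-! ## §4 The (A13) parity statement on the concrete pair -/

/-- The trace `Tr_{Lw/Kv}` is continuous: a linear map out of a finite-dimensional Hausdorff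
topological vector space over the complete non-trivially normed field `Kv` (the norm topology of
`Kv` is its valuation topology by construction of `Valued.toNormedField`). -/
theorem continuous_trace :
    Continuous (Algebra.trace (v.adicCompletion K) (w.adicCompletion L)) :=
  LinearMap.continuous_of_finiteDimensional _

/-- `ψ ∘ Tr` is continuous when `ψ` is. -/
theorem continuous_comp_trace {M : Type*} [Monoid M] [TopologicalSpace M]
    (ψ : AddChar (v.adicCompletion K) M) (hψ : Continuous ψ) :
    Continuous (ψ.compAddMonoidHom
      (Algebra.trace (v.adicCompletion K) (w.adicCompletion L)).toAddMonoidHom) :=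
  hψ.comp (continuous_trace v w)

/-- `ψ ∘ Tr` is non-trivial when `ψ` is (the trace is onto, `Lw / Kv` separable). -/
theorem exists_comp_trace_ne_one {M : Type*} [Monoid M] (ψ : AddChar (v.adicCompletion K) M)
    (hψ₁ : ∃ y, ψ y ≠ 1) :
    ∃ z, (ψ.compAddMonoidHom
      (Algebra.trace (v.adicCompletion K) (w.adicCompletion L)).toAddMonoidHom) z ≠ 1 := by
  obtain ⟨y, hy⟩ := hψ₁
  obtain ⟨z, hz⟩ := Algebra.trace_surjective (v.adicCompletion K) (w.adicCompletion L) y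
  exact ⟨z, by simpa [AddChar.compAddMonoidHom_apply, hz] using hy⟩

omit [Algebra K L] [Algebra (v.adicCompletion K) (w.adicCompletion L)]
  [ContinuousSMul (v.adicCompletion K) (w.adicCompletion L)]
  [IsScalarTower K (v.adicCompletion K) (w.adicCompletion L)] in
/-- The valuation of `Kv` restricted to `O_Kv` is `≤ 1`. -/
theorem comap_le_one (a : v.adicCompletionIntegers K) :
    (Valued.v : Valuation (v.adicCompletion K) ℤᵐ⁰).comap
      (algebraMap (v.adicCompletionIntegers K) (v.adicCompletion K)) a ≤ 1 :=
  a.2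

omit [Algebra K L] [Algebra (v.adicCompletion K) (w.adicCompletion L)]
  [ContinuousSMul (v.adicCompletion K) (w.adicCompletion L)]
  [IsScalarTower K (v.adicCompletion K) (w.adicCompletion L)] in
/-- The restricted valuation vanishes only at `0`. -/
theorem comap_ne_zero_iff (a : v.adicCompletionIntegers K) :
    (Valued.v : Valuation (v.adicCompletion K) ℤᵐ⁰).comap
      (algebraMap (v.adicCompletionIntegers K) (v.adicCompletion K)) a ≠ 0 ↔ a ≠ 0 := by
  rw [Valuation.comap_apply, Valuation.ne_zero_iff]
  exact (FaithfulSMul.algebraMap_injective (v.adicCompletionIntegers K)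
    (v.adicCompletion K)).ne_iff' (map_zero _)

/-- THE (A13) CAPSTONE on the concrete pair (row 68's `even_conductor_of_inertiaDeg'_eq_one` with
every dictionary hypothesis discharged): at a ramified quadratic place (`[Lw : Kv] = 2`, `f = 1`),
for `s ∈ O_Lw ∖ O_Kv` with `s² = D ∈ O_Kv ∖ {0}`, `δ = c · s` (`c ≠ 0`), uniformisers `ϖ`, `π` and
the different `(π ^ d)`, the integer `2 n + ord δ + d` is even for every `n`. -/
theorem even_two_mul_add_ord_add (h2 : Module.finrank (v.adicCompletion K) (w.adicCompletion L) = 2)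
    (π : w.adicCompletionIntegers L) (hπ : Irreducible π) (ϖ : v.adicCompletionIntegers K)
    (hϖ : Irreducible ϖ) (hf : (Ideal.span {ϖ}).inertiaDeg' (Ideal.span {π}) = 1) (d : ℕ)
    (hd : differentIdeal (v.adicCompletionIntegers K) (w.adicCompletionIntegers L) =
      Ideal.span {π ^ d})
    (s : w.adicCompletionIntegers L) (D : v.adicCompletionIntegers K)
    (hs : s * s = algebraMap (v.adicCompletionIntegers K) (w.adicCompletionIntegers L) D)
    (hs' : s ∉ Set.range (algebraMap (v.adicCompletionIntegers K) (w.adicCompletionIntegers L)))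
    (hD : D ≠ 0) (δ : w.adicCompletion L) (c : v.adicCompletion K) (hc : c ≠ 0)
    (hδ : δ = algebraMap (v.adicCompletion K) (w.adicCompletion L) c *
      algebraMap (w.adicCompletionIntegers L) (w.adicCompletion L) s) (n : ℤ) :
    Even (2 * n + T5RamifiedParity.ord (Valued.v : Valuation (w.adicCompletion L) ℤᵐ⁰) δ + d) :=
  T5RamificationIndexUniformizer.even_conductor_of_inertiaDeg'_eq_one
    (v.adicCompletionIntegers K) (v.adicCompletion K) (w.adicCompletion L)
    (w.adicCompletionIntegers L) h2 π hπ ϖ hϖ hf d hd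
    ((Valued.v : Valuation (v.adicCompletion K) ℤᵐ⁰).comap
      (algebraMap (v.adicCompletionIntegers K) (v.adicCompletion K)))
    (comap_le_one v) ((irreducible_iff_val_eq_exp_neg_one v ϖ).mp hϖ) Valued.v (fun b => b.2)
    ((irreducible_iff_val_eq_exp_neg_one w π).mp hπ) s D hs hs' ((comap_ne_zero_iff v D).mpr hD)
    ((comap_ne_zero_iff v 2).mpr two_ne_zero) δ c hc hδ n

/-- THE (A13) STATEMENT «`d_v = n(ψ_{δ,v})` is even» on Mathlib's number-field completions: for a
continuous non-trivial `ψ : AddChar Kv Circle`, at a ramified quadratic place and for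
`δ = c · √D` as above, the conductor of `ψ ∘ Tr_{Lw/Kv} ∘ (δ ·)` is even. Proof: row 67's twist
formula `n(χ(δ ·)) = n(χ) + ord δ` for `χ = ψ ∘ Tr` (continuous, hence trivial on a ball by
p395675; non-trivial by the surjectivity of the trace), the conductor formula
`n(ψ ∘ Tr) = 2 n(ψ) + d` of §3, and `even_two_mul_add_ord_add` with `n = n(ψ)`. -/
theorem even_conductorExp_comp_trace_mulLeft
    (h2 : Module.finrank (v.adicCompletion K) (w.adicCompletion L) = 2)
    (ψ : AddChar (v.adicCompletion K) Circle) (hψ : Continuous ψ) (hψ₁ : ∃ y, ψ y ≠ 1)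
    (π : w.adicCompletionIntegers L) (hπ : Irreducible π) (ϖ : v.adicCompletionIntegers K)
    (hϖ : Irreducible ϖ) (hf : (Ideal.span {ϖ}).inertiaDeg' (Ideal.span {π}) = 1) (d : ℕ)
    (hd : differentIdeal (v.adicCompletionIntegers K) (w.adicCompletionIntegers L) =
      Ideal.span {π ^ d})
    (s : w.adicCompletionIntegers L) (D : v.adicCompletionIntegers K)
    (hs : s * s = algebraMap (v.adicCompletionIntegers K) (w.adicCompletionIntegers L) D)
    (hs' : s ∉ Set.range (algebraMap (v.adicCompletionIntegers K) (w.adicCompletionIntegers L)))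
    (hD : D ≠ 0) (δ : w.adicCompletion L) (c : v.adicCompletion K) (hc : c ≠ 0)
    (hδ : δ = algebraMap (v.adicCompletion K) (w.adicCompletion L) c *
      algebraMap (w.adicCompletionIntegers L) (w.adicCompletion L) s) :
    Even (T5AdditiveConductor.conductorExp
      ((ψ.compAddMonoidHom
        (Algebra.trace (v.adicCompletion K) (w.adicCompletion L)).toAddMonoidHom).compAddMonoidHom
          (AddMonoidHom.mulLeft δ)) (Valued.v : Valuation (w.adicCompletion L) ℤᵐ⁰)) := by
  have hs0 : s ≠ 0 := by
    rintro rfl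
    rw [mul_zero, eq_comm, map_eq_zero_iff _ (FaithfulSMul.algebraMap_injective _ _)] at hs
    exact hD hs
  have hδ0 : δ ≠ 0 := by
    rw [hδ]
    exact mul_ne_zero ((map_ne_zero _).mpr hc)
      ((map_ne_zero_iff _ (FaithfulSMul.algebraMap_injective _ _)).mpr hs0)
  have hord : Valued.v δ = exp (-(T5RamifiedParity.ord
      (Valued.v : Valuation (w.adicCompletion L) ℤᵐ⁰) δ)) := by
    unfold T5RamifiedParity.ord
    rw [neg_neg, exp_log ((Valuation.ne_zero_iff _).mpr hδ0)]
  rw [T5AdditiveConductor.conductorExp_compAddMonoidHom_mulLeft _ _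
      (T5ValuedBallBasis.exists_forall_le_exp_eq_one_of_continuous _
        (continuous_comp_trace v w ψ hψ))
      (exists_comp_trace_ne_one v w ψ hψ₁) δ hδ0 _ hord,
    conductorExp_comp_trace_eq_two_mul_add v w h2 ψ
      (T5ValuedBallBasis.exists_forall_le_exp_eq_one_of_continuous ψ hψ) hψ₁ ϖ hϖ π hπ hf d hd]
  have := even_two_mul_add_ord_add v w h2 π hπ ϖ hϖ hf d hd s D hs hs' hD δ c hc hδ
    (T5AdditiveConductor.conductorExp ψ (Valued.v : Valuation (v.adicCompletion K) ℤᵐ⁰))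
  convert this using 1
  ring

end Pair

end Summit.Ventures.HodgeRepro2.T5AdicCompletionConductor
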